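import Summits.CriticalPhenomena.PercolationContinuityZ3.Theorems.PercNearOneGluingNoHeavyLowerTailSahiOneStepCone
import HarnessLib

/-!
# One-step scheme: monotonicity of `N_t` in the second argument and CONE CERTIFICATES for `(2′)`

Support file (prover prim-ineq-prove-3 gen 30; `--supports stmt-CriticalPhenomena-4575`; memo
`run/shared/lean/prim/prim-ineq-prove-3/PROOF-G30-SHIFTED-PARTNER.md` §8).  No definitions, no named facts, no sorries, no `native_decide`.

For a fixed first argument `f` with `E f ≥ 0` and `E[1_H f] ≥ E[1_H]·E[f]` (Harris, e.g. `f = 1_A`, `A`, `H` increasing), the functional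
`g ↦ N(H; f, g)` depends on `g` only through `E[1_H g]` (coefficient `−(1 − E1_H)·E f ≤ 0`), `E[1_{Hᶜ} g]` (coefficient `−Cov(1_H, f) ≤ 0`) and
`E[1_H f g]` (coefficient `1 − E1_H ≥ 0`):
* `osN_sub_osN_eq` — the identity; `osN_le_osN_of_surrogate` — `N(f, g′) ≤ N(f, g)` as soon as `E[1_H g′] ≥ E[1_H g]`, `E[1_{Hᶜ} g′] ≥ E[1_{Hᶜ} g]`
  and `E[1_H f g′] ≤ E[1_H f g]` (the RELAXED surrogate comparison; `…FuzzyReduce.osN_surrogate_le` is the equality case);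
* `osN_sum_smul_right` — linearity in the second argument over finite nonnegative combinations;
* **`osN_nonneg_of_coneCertificate`** — if `ψ = Σ_k c_k g_k` (`c_k ≥ 0`) with `N(f, g_k) ≥ 0` for all `k` dominates `g` in the above sense, then
  `N(f, g) ≥ N(f, ψ) = Σ c_k N(f, g_k) ≥ 0`.  With THEOREM SP (`…ShiftedPartner`: `N_t(1_A, 1_V) ≥ 0` for every shifted `V`, `A` arbitrary) this is
  the certificate format "SC2/SC3" of the memo for pairs in which neither event is shifted.
-/

noncomputable section

namespace Summit.CriticalPhenomena.PercolationContinuityZ3.Theorems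

namespace SahiOneStep

open Literature.Combinatorics.Sahi2008
open Literature.Probability.Percolation.DecisionTree (ind)
open scoped Classical

variable {ι : Type*} [Fintype ι]

/-- **The second-argument identity**: `N(f,g) − N(f,g′) = (1−E1_H)·Ef·(E[1_H g′] − E[1_H g]) + (E[1_H f] − E1_H·Ef)·(E[1_{Hᶜ} g′] − E[1_{Hᶜ} g])
+ (1−E1_H)·(E[1_H f g] − E[1_H f g′])` (with `E[1_{Hᶜ} g] = E g − E[1_H g]`). [this work] -/
theorem osN_sub_osN_eq (p : ι → unitInterval) (H : Set (Set ι)) (f g g' : Set ι → ℝ) :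
    osN p H f g - osN p H f g' =
      (1 - ex (bernoulliWeight p) (ind H)) * ex (bernoulliWeight p) f *
          (ex (bernoulliWeight p) (ind H * g') - ex (bernoulliWeight p) (ind H * g)) +
        (ex (bernoulliWeight p) (ind H * f) - ex (bernoulliWeight p) (ind H) * ex (bernoulliWeight p) f) *
          ((ex (bernoulliWeight p) g' - ex (bernoulliWeight p) (ind H * g')) - (ex (bernoulliWeight p) g - ex (bernoulliWeight p) (ind H * g))) +
        (1 - ex (bernoulliWeight p) (ind H)) * (ex (bernoulliWeight p) (ind H * f * g) - ex (bernoulliWeight p) (ind H * f * g')) := by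
  unfold osN osCert
  ring

/-- **Relaxed surrogate comparison.**  If `E f ≥ 0`, `E[1_H f] ≥ E1_H·E f`, and `g′` has at least the `H`-mass and at least the `Hᶜ`-mass of `g` and
at most its `H`-overlap with `f`, then `N(H; f, g′) ≤ N(H; f, g)`. [this work] -/
theorem osN_le_osN_of_surrogate (p : ι → unitInterval) (H : Set (Set ι)) (f g g' : Set ι → ℝ)
    (hf0 : 0 ≤ ex (bernoulliWeight p) f)
    (hcov : ex (bernoulliWeight p) (ind H) * ex (bernoulliWeight p) f ≤ ex (bernoulliWeight p) (ind H * f))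
    (hH : ex (bernoulliWeight p) (ind H * g) ≤ ex (bernoulliWeight p) (ind H * g'))
    (hL : ex (bernoulliWeight p) g - ex (bernoulliWeight p) (ind H * g) ≤ ex (bernoulliWeight p) g' - ex (bernoulliWeight p) (ind H * g'))
    (hov : ex (bernoulliWeight p) (ind H * f * g') ≤ ex (bernoulliWeight p) (ind H * f * g)) :
    osN p H f g' ≤ osN p H f g := by
  have h := osN_sub_osN_eq p H f g g'
  have hl : 0 ≤ 1 - ex (bernoulliWeight p) (ind H) := by
    rw [sub_nonneg, ex_bernoulliWeight_ind]; exact MeasureTheory.measureReal_le_one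
  have h1 : 0 ≤ (1 - ex (bernoulliWeight p) (ind H)) * ex (bernoulliWeight p) f *
      (ex (bernoulliWeight p) (ind H * g') - ex (bernoulliWeight p) (ind H * g)) :=
    mul_nonneg (mul_nonneg hl hf0) (sub_nonneg.2 hH)
  have h2 : 0 ≤ (ex (bernoulliWeight p) (ind H * f) - ex (bernoulliWeight p) (ind H) * ex (bernoulliWeight p) f) *
      ((ex (bernoulliWeight p) g' - ex (bernoulliWeight p) (ind H * g')) - (ex (bernoulliWeight p) g - ex (bernoulliWeight p) (ind H * g))) :=
    mul_nonneg (sub_nonneg.2 hcov) (sub_nonneg.2 hL)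
  have h3 : 0 ≤ (1 - ex (bernoulliWeight p) (ind H)) * (ex (bernoulliWeight p) (ind H * f * g) - ex (bernoulliWeight p) (ind H * f * g')) :=
    mul_nonneg hl (sub_nonneg.2 hov)
  linarith

/-- `N(f, 0) = 0`. [this work] -/
theorem osN_zero_right (p : ι → unitInterval) (H : Set (Set ι)) (f : Set ι → ℝ) : osN p H f 0 = 0 := by
  have h := osN_add_smul_left p H 0 0 f 1
  simp only [smul_zero, add_zero, one_mul] at h
  rw [osN_comm]
  linarith

/-- **Linearity in the second argument over a finite combination**: `N(f, Σ_k c_k g_k) = Σ_k c_k N(f, g_k)`. [this work] -/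
theorem osN_sum_smul_right {κ : Type*} (p : ι → unitInterval) (H : Set (Set ι)) (f : Set ι → ℝ) (s : Finset κ) (c : κ → ℝ)
    (g : κ → Set ι → ℝ) :
    osN p H f (fun ω => ∑ k ∈ s, c k * g k ω) = ∑ k ∈ s, c k * osN p H f (g k) := by
  induction s using Finset.induction_on with
  | empty =>
    simp only [Finset.sum_empty]
    exact osN_zero_right p H f
  | insert a s ha ih =>
    rw [Finset.sum_insert ha]
    have hfun : (fun ω => ∑ k ∈ insert a s, c k * g k ω) = (fun ω => ∑ k ∈ s, c k * g k ω) + c a • g a := by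
      funext ω
      rw [Finset.sum_insert ha, Pi.add_apply, Pi.smul_apply, smul_eq_mul, add_comm]
    rw [hfun, osN_comm, osN_add_smul_left, osN_comm, ih, osN_comm p H (g a) f, add_comm]

/-- **CONE CERTIFICATE FOR `(2′)`.**  Let `E f ≥ 0` and `E[1_H f] ≥ E1_H·E f`.  If `ψ = Σ_{k ∈ s} c_k g_k` with `c_k ≥ 0` and `N(H; f, g_k) ≥ 0`
for all `k`, and `E[1_H ψ] ≥ E[1_H g]`, `E[1_{Hᶜ} ψ] ≥ E[1_{Hᶜ} g]`, `E[1_H f ψ] ≤ E[1_H f g]`, then `N(H; f, g) ≥ 0`. [this work] -/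
theorem osN_nonneg_of_coneCertificate {κ : Type*} (p : ι → unitInterval) (H : Set (Set ι)) (f g : Set ι → ℝ)
    (hf0 : 0 ≤ ex (bernoulliWeight p) f)
    (hcov : ex (bernoulliWeight p) (ind H) * ex (bernoulliWeight p) f ≤ ex (bernoulliWeight p) (ind H * f))
    (s : Finset κ) (c : κ → ℝ) (hc : ∀ k ∈ s, 0 ≤ c k) (gk : κ → Set ι → ℝ) (hpos : ∀ k ∈ s, 0 ≤ osN p H f (gk k))
    (hH : ex (bernoulliWeight p) (ind H * g) ≤ ex (bernoulliWeight p) (ind H * fun ω => ∑ k ∈ s, c k * gk k ω))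
    (hL : ex (bernoulliWeight p) g - ex (bernoulliWeight p) (ind H * g) ≤
      ex (bernoulliWeight p) (fun ω => ∑ k ∈ s, c k * gk k ω) - ex (bernoulliWeight p) (ind H * fun ω => ∑ k ∈ s, c k * gk k ω))
    (hov : ex (bernoulliWeight p) (ind H * f * fun ω => ∑ k ∈ s, c k * gk k ω) ≤ ex (bernoulliWeight p) (ind H * f * g)) :
    0 ≤ osN p H f g := by
  have hψ : 0 ≤ osN p H f (fun ω => ∑ k ∈ s, c k * gk k ω) := by
    rw [osN_sum_smul_right]
    exact Finset.sum_nonneg fun k hk => mul_nonneg (hc k hk) (hpos k hk)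
  exact hψ.trans (osN_le_osN_of_surrogate p H f g _ hf0 hcov hH hL hov)

end SahiOneStep

end Summit.CriticalPhenomena.PercolationContinuityZ3.Theorems
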